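import Summits.ValiantsHypothesis.ValiantsHypothesis.Theorems.KPlusLogSqLawTropicalBRegisterPairGadget

/-!
# Route «KPlusLogSqLaw», crux `TropicalB` (stmt-ValiantsHypothesis-19771) — THE REGISTER-PAIR LAW for COLUMN-TYPED gadgets

HONEST FRAMING.  Helper toward the registered stubs `stub_tropThin` / `stub_tropFat` of `Cruxes/TropicalB/Lines/birth.lean` (crux
`Summit.ValiantsHypothesis.ValiantsHypothesis.Theses.KPlusLogSqLaw.TropicalB`, item stmt-ValiantsHypothesis-19771, route KPlusLogSqLaw;
cell `pub-symmetroid`, seat val-sym-trop-p4 g11, 2026-08-27; `--supports … --as helper`).  The register-pair law of …TropicalBRegisterPair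
with the one-class hypothesis on the gadget relaxed to COLUMN-TYPED classes: every family term uses, on the gadget column `g`, the class `κ g`
of that column (`κ : Fin m → Fin K` arbitrary) — so coupling columns may carry slope classes (e.g. the exposed column of a third, column-hole
register joining the gadget with its own class).  Re-matching the gadget then keeps every column's class, hence the slope, and the proof of
…TropicalBRegisterPair goes through verbatim with the weights `v r g (κ g)`.  A STRUCTURE (no-go) theorem about unique optima of an arbitrary
design; nothing here bounds `TropicalB`, and nothing bears on `WeakLifting`, DoorA26 / DoorA34, `MatrixDescartes` (stmt-ValiantsHypothesis-18050)
or VP ≠ VNP.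

* `gadget_min_typed` — gadget minimality with column-typed classes;
* `registerPair_law_typed` — no `3 × 3` product of dominant terms over two same-side row registers read by one column-typed gadget.
[folklore: valuated-matroid exchange (Murota 2003 §9) + hull convexity; the packaging is the cell's]
-/

set_option linter.dupNamespace false
set_option autoImplicit false

namespace Summit.ValiantsHypothesis.ValiantsHypothesis.Theorems.KPlusLogSqLaw

namespace RegisterPair

open Summit.ValiantsHypothesis.ValiantsHypothesis.Theorems.MatrixDescartes.Negative
open Summit.ValiantsHypothesis.ValiantsHypothesis.Theorems.LacunarySymmetroidMatrixDescartes
open Summit.ValiantsHypothesis.ValiantsHypothesis.Theorems.LacunarySymmetroidMatrixDescartes.TropicalCensus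
open Summit.ValiantsHypothesis.ValiantsHypothesis.Theorems.KPlusLogSqLaw.MatchingExchange
open Literature.Computability.MetaComplexity.PBij
open scoped BigOperators
open Finset

variable {m K : ℕ}

/-- **GADGET MINIMALITY, column-typed.**  If `p` is the unique optimum at `θ` and uses on every gadget column `g ∈ G` the class `κ g`, then
among ALL matchings of `G` into the same rows through present cells of the columns' classes, the gadget part of `p` has the least valuation sum
(re-matching the gadget keeps every column's class, so the competitor is a present term of the same slope). [folklore] -/
theorem gadget_min_typed (d : Fin K → ℕ) (v ε : Fin m → Fin m → Fin K → ℤ) {θ : ℤ}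
    {p : Equiv.Perm (Fin m) × (Fin m → Fin K)} (hp : IsDominant d v ε θ p) (G : Finset (Fin m)) (κ : Fin m → Fin K)
    (hcls : ∀ g ∈ G, p.2 g = κ g) {Y : Finset (Fin m × Fin m)} (hY : IsPMatching Y) (hrng : rng Y = G)
    (hdom : dom Y = G.image p.1) (hpres : ∀ e ∈ Y, ε e.1 e.2 (κ e.2) ≠ 0) :
    ∑ g ∈ G, v (p.1 g) g (κ g) ≤ ∑ e ∈ Y, v e.1 e.2 (κ e.2) := by
  classical
  -- the row of `Y` at a gadget column
  have huniq : ∀ c, c ∈ G → ∃! e, e ∈ Y ∧ e.2 = c := by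
    intro c hc
    obtain ⟨a, ha⟩ := mem_rng.1 (hrng.symm ▸ hc)
    exact ⟨(a, c), ⟨ha, rfl⟩, fun e he => hY e he.1 (a, c) ha (Or.inr he.2)⟩
  let σ' : Fin m → Fin m := fun c => if hc : c ∈ G then (Y.choose (fun e => e.2 = c) (huniq c hc)).1 else p.1 c
  have hσ'G : ∀ c, c ∈ G → (σ' c, c) ∈ Y := by
    intro c hc
    have hspec := Finset.choose_spec (fun e => e.2 = c) Y (huniq c hc)
    have h1 : σ' c = (Y.choose (fun e => e.2 = c) (huniq c hc)).1 := by simp only [σ', dif_pos hc]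
    rw [h1]
    have h2 : ((Y.choose (fun e => e.2 = c) (huniq c hc)).1, c) = Y.choose (fun e => e.2 = c) (huniq c hc) :=
      Prod.ext rfl hspec.2.symm
    rw [h2]; exact hspec.1
  have hσ'nG : ∀ c, c ∉ G → σ' c = p.1 c := fun c hc => by simp only [σ', dif_neg hc]
  have hσ'dom : ∀ c, c ∈ G → σ' c ∈ G.image p.1 := fun c hc => hdom ▸ mem_dom.2 ⟨c, hσ'G c hc⟩
  -- `σ'` is a permutation
  have hinj : Function.Injective σ' := by
    intro c c' h
    by_cases hc : c ∈ G <;> by_cases hc' : c' ∈ G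
    · have e1 := hσ'G c hc
      have e2 := hσ'G c' hc'
      rw [h] at e1
      exact (Prod.mk.inj (hY _ e1 _ e2 (Or.inl rfl))).2
    · exfalso
      obtain ⟨g, hg, hgc⟩ := Finset.mem_image.1 (hσ'dom c hc)
      rw [h, hσ'nG c' hc'] at hgc
      exact hc' (p.1.injective hgc ▸ hg)
    · exfalso
      obtain ⟨g, hg, hgc⟩ := Finset.mem_image.1 (hσ'dom c' hc')
      rw [← h, hσ'nG c hc] at hgc
      exact hc (p.1.injective hgc ▸ hg)
    · rw [hσ'nG c hc, hσ'nG c' hc'] at h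
      exact p.1.injective h
  let π : Equiv.Perm (Fin m) := Equiv.ofBijective σ' (Finite.injective_iff_bijective.1 hinj)
  have hπ : ∀ c, π c = σ' c := fun c => rfl
  -- `Y` is the gadget part of the new term
  have hYeq : Y = G.image fun g => (σ' g, g) := by
    ext e
    constructor
    · intro he
      have hc : e.2 ∈ G := hrng ▸ mem_rng.2 ⟨e.1, he⟩
      have h1 := hσ'G e.2 hc
      have : e = (σ' e.2, e.2) := hY _ he _ h1 (Or.inr rfl)
      exact Finset.mem_image.2 ⟨e.2, hc, this.symm⟩
    · intro he
      obtain ⟨g, hg, rfl⟩ := Finset.mem_image.1 he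
      exact hσ'G g hg
  have hwY : ∑ e ∈ Y, v e.1 e.2 (κ e.2) = ∑ g ∈ G, v (σ' g) g (κ g) := by
    rw [hYeq]; exact wt_gad π G (fun a c => v a c (κ c))
  -- the new term is present and has the same slope
  set p' : Equiv.Perm (Fin m) × (Fin m → Fin K) := (π, p.2) with hp'def
  have hpres' : termSign ε p' ≠ 0 := by
    rw [termSign_ne_zero_iff]
    intro c
    by_cases hc : c ∈ G
    · show ε (σ' c) c (p.2 c) ≠ 0
      rw [hcls c hc]; exact hpres _ (hσ'G c hc)
    · show ε (σ' c) c (p.2 c) ≠ 0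
      rw [hσ'nG c hc]; exact (termSign_ne_zero_iff ε p).1 hp.1 c
  -- split the valuation sums along `G`
  have hsplit : ∀ f : Fin m → ℤ, ∑ i, f i = (∑ i ∈ G, f i) + ∑ i ∈ Gᶜ, f i :=
    fun f => (Finset.sum_add_sum_compl G f).symm
  have hVp : ∑ i, v (p.1 i) i (p.2 i) = (∑ g ∈ G, v (p.1 g) g (κ g)) + ∑ i ∈ Gᶜ, v (p.1 i) i (p.2 i) := by
    rw [hsplit]
    congr 1
    exact Finset.sum_congr rfl fun g hg => by rw [hcls g hg]
  have hVp' : ∑ i, v (p'.1 i) i (p'.2 i) = (∑ e ∈ Y, v e.1 e.2 (κ e.2)) + ∑ i ∈ Gᶜ, v (p.1 i) i (p.2 i) := by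
    rw [hsplit, hwY]
    congr 1
    · exact Finset.sum_congr rfl fun g hg => by rw [hcls g hg]; rfl
    · exact Finset.sum_congr rfl fun i hi => by
        rw [Finset.mem_compl] at hi
        show v (σ' i) i (p.2 i) = _
        rw [hσ'nG i hi]
  by_cases hpp : p' = p
  · -- the re-matched gadget is the old one
    have : ∑ i, v (p'.1 i) i (p'.2 i) = ∑ i, v (p.1 i) i (p.2 i) := by rw [hpp]
    rw [hVp, hVp'] at this
    linarith
  · have hlt := hp.2 p' hpp hpres'
    rw [tropWeight_eq_slope_sub, tropWeight_eq_slope_sub] at hlt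
    have hslope : slope d p' = slope d p := rfl
    rw [hslope, hVp, hVp'] at hlt
    linarith


/-- **THE REGISTER-PAIR LAW, column-typed gadget** (no `3 × 3` product of dominant terms over two same-side row registers read by one gadget
whose column `g` always carries the class `κ g`).  See the module docstring. [folklore: valuated-matroid exchange (Murota 2003 §9) + hull
convexity; the packaging is the cell's] -/
theorem registerPair_law_typed (d : Fin K → ℕ) (v ε : Fin m → Fin m → Fin K → ℤ)
    (G N : Finset (Fin m)) (κ : Fin m → Fin K) (rI rJ : Fin 3 → Fin m)
    (u : Fin 3 → Fin 3 → Equiv.Perm (Fin m) × (Fin m → Fin K)) (θ : Fin 3 → Fin 3 → ℤ)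
    (hdom : ∀ a b, IsDominant d v ε (θ a b) (u a b))
    (hθI : ∀ a a' b, a < a' → θ a b < θ a' b) (hθJ : ∀ a b b', b < b' → θ a b < θ a b')
    (hcls : ∀ a b, ∀ g ∈ G, (u a b).2 g = κ g)
    (himg : ∀ a b, G.image (u a b).1 = insert (rI a) (insert (rJ b) N))
    (hIN : ∀ a, rI a ∉ N) (hJN : ∀ b, rJ b ∉ N) (hIJ : ∀ a b, rI a ≠ rJ b)
    (hI : Function.Injective rI) (hJ : Function.Injective rJ)
    (hout : ∀ c, c ∉ G →
      (∀ a b b', ((u a b).1 c, (u a b).2 c) = ((u a b').1 c, (u a b').2 c)) ∨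
      (∀ a a' b, ((u a b).1 c, (u a b).2 c) = ((u a' b).1 c, (u a' b).2 c))) :
    False := by
  classical
  -- presence of every cell of the family, in particular of the gadget cells at their columns' classes
  have hpresu : ∀ a b c, ε ((u a b).1 c) c ((u a b).2 c) ≠ 0 := fun a b => (termSign_ne_zero_iff ε _).1 (hdom a b).1
  have hpresG : ∀ a b, ∀ e ∈ G.image (fun g => ((u a b).1 g, g)), ε e.1 e.2 (κ e.2) ≠ 0 := by
    intro a b e he
    obtain ⟨g, hg, rfl⟩ := Finset.mem_image.1 he
    have := hpresu a b g
    rwa [hcls a b g hg] at this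
  -- distinct indices give distinct terms (the exposed rows differ)
  have hN_sub : ∀ a b, N ⊆ G.image (u a b).1 := fun a b => by
    rw [himg]; exact (Finset.subset_insert _ _).trans (Finset.subset_insert _ _)
  have hneJ : ∀ a b b', b ≠ b' → u a b ≠ u a b' := by
    intro a b b' hbb h
    have h1 : rJ b ∈ G.image (u a b').1 := by rw [← h, himg]; simp
    rw [himg] at h1
    rcases Finset.mem_insert.1 h1 with h1 | h1
    · exact hIJ a b h1.symm
    · rcases Finset.mem_insert.1 h1 with h1 | h1
      · exact hbb (hJ h1)
      · exact hJN b h1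
  have hneI : ∀ a a' b, a ≠ a' → u a b ≠ u a' b := by
    intro a a' b haa h
    have h1 : rI a ∈ G.image (u a' b).1 := by rw [← h, himg]; simp
    rw [himg] at h1
    rcases Finset.mem_insert.1 h1 with h1 | h1
    · exact haa (hI h1)
    · rcases Finset.mem_insert.1 h1 with h1 | h1
      · exact hIJ a b h1
      · exact hIN a h1
  -- slopes increase with each index
  have hsJ : ∀ a b b', b < b' → slope d (u a b) < slope d (u a b') := fun a b b' h =>
    slope_lt_of_dominant d v ε (hθJ a b b' h) (hneJ a b b' (ne_of_lt h)) (hdom a b) (hdom a b')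
  have hsI : ∀ a a' b, a < a' → slope d (u a b) < slope d (u a' b) := fun a a' b h =>
    slope_lt_of_dominant d v ε (hθI a a' b h) (hneI a a' b (ne_of_lt h)) (hdom a b) (hdom a' b)
  -- gadget values and the split of the columnwise sums
  set VG : Fin 3 → Fin 3 → ℤ := fun a b => ∑ g ∈ G, v ((u a b).1 g) g (κ g) with hVGdef
  have hsplit : ∀ f : Fin m → ℤ, ∑ i, f i = (∑ i ∈ G, f i) + ∑ i ∈ Gᶜ, f i :=
    fun f => (Finset.sum_add_sum_compl G f).symm
  -- modularity off the gadget: slopes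
  have hSmod : ∀ a a' b b', slope d (u a b) + slope d (u a' b') = slope d (u a b') + slope d (u a' b) := by
    intro a a' b b'
    unfold TropicalCensus.slope
    rw [← Finset.sum_add_distrib, ← Finset.sum_add_distrib]
    refine Finset.sum_congr rfl fun c _ => ?_
    by_cases hc : c ∈ G
    · rw [hcls a b c hc, hcls a' b' c hc, hcls a b' c hc, hcls a' b c hc]
    · rcases hout c hc with h | h
      · have e1 := congrArg (fun q : Fin m × Fin K => (d q.2 : ℤ)) (h a b b')
        have e2 := congrArg (fun q : Fin m × Fin K => (d q.2 : ℤ)) (h a' b b')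
        simp only at e1 e2
        linarith
      · have e1 := congrArg (fun q : Fin m × Fin K => (d q.2 : ℤ)) (h a a' b)
        have e2 := congrArg (fun q : Fin m × Fin K => (d q.2 : ℤ)) (h a a' b')
        simp only at e1 e2
        linarith
  -- modularity off the gadget: valuations, up to the gadget values
  have hVmod : ∀ a a' b b',
      (∑ i, v ((u a b).1 i) i ((u a b).2 i)) + (∑ i, v ((u a' b').1 i) i ((u a' b').2 i)) - VG a b - VG a' b' =
      (∑ i, v ((u a b').1 i) i ((u a b').2 i)) + (∑ i, v ((u a' b).1 i) i ((u a' b).2 i)) - VG a b' - VG a' b := by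
    intro a a' b b'
    have hG : ∀ x y, ∑ i ∈ G, v ((u x y).1 i) i ((u x y).2 i) = VG x y := fun x y =>
      Finset.sum_congr rfl fun g hg => by rw [hcls x y g hg]
    rw [hsplit (fun i => v ((u a b).1 i) i ((u a b).2 i)), hsplit (fun i => v ((u a' b').1 i) i ((u a' b').2 i)),
      hsplit (fun i => v ((u a b').1 i) i ((u a b').2 i)), hsplit (fun i => v ((u a' b).1 i) i ((u a' b).2 i)),
      hG, hG, hG, hG]
    have hC : (∑ i ∈ Gᶜ, v ((u a b).1 i) i ((u a b).2 i)) + ∑ i ∈ Gᶜ, v ((u a' b').1 i) i ((u a' b').2 i) =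
        (∑ i ∈ Gᶜ, v ((u a b').1 i) i ((u a b').2 i)) + ∑ i ∈ Gᶜ, v ((u a' b).1 i) i ((u a' b).2 i) := by
      rw [← Finset.sum_add_distrib, ← Finset.sum_add_distrib]
      refine Finset.sum_congr rfl fun c hc => ?_
      rw [Finset.mem_compl] at hc
      rcases hout c hc with h | h
      · have e1 := congrArg (fun q : Fin m × Fin K => v q.1 c q.2) (h a b b')
        have e2 := congrArg (fun q : Fin m × Fin K => v q.1 c q.2) (h a' b b')
        simp only at e1 e2
        linarith
      · have e1 := congrArg (fun q : Fin m × Fin K => v q.1 c q.2) (h a a' b)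
        have e2 := congrArg (fun q : Fin m × Fin K => v q.1 c q.2) (h a a' b')
        simp only at e1 e2
        linarith
    linarith
  -- (L1) strict supermodularity of the gadget values
  have L1 : ∀ a a' b b', a < a' → b < b' → VG a b' + VG a' b < VG a b + VG a' b' := by
    intro a a' b b' ha hb
    have hpar := parallelogram d v ε (hdom a b') (hdom a' b) (hdom a b).1 (hdom a' b').1 (hSmod a a' b b')
      (hsJ a b b' hb) (hsI a a' b ha)
    have := hVmod a a' b b'
    linarith
  -- the gadget parts as matchings
  have hM : ∀ a b, IsPMatching (G.image fun g => ((u a b).1 g, g)) := fun a b => isPMatching_gad _ _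
  have hMdom : ∀ a b, dom (G.image fun g => ((u a b).1 g, g)) = insert (rI a) (insert (rJ b) N) := fun a b => by
    rw [dom_gad, himg]
  have hMwt : ∀ a b, ∑ e ∈ G.image (fun g => ((u a b).1 g, g)), v e.1 e.2 (κ e.2) = VG a b := fun a b =>
    wt_gad _ _ (fun x c => v x c (κ c))
  -- gadget minimality in the form used below
  have hmin : ∀ a b (Y : Finset (Fin m × Fin m)), IsPMatching Y → rng Y = G →
      dom Y = insert (rI a) (insert (rJ b) N) → (∀ e ∈ Y, ε e.1 e.2 (κ e.2) ≠ 0) → VG a b ≤ ∑ e ∈ Y, v e.1 e.2 (κ e.2) :=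
    fun a b Y hY hr hd hp => gadget_min_typed d v ε (hdom a b) G κ (hcls a b) hY hr ((himg a b).symm ▸ hd) hp
  -- (L3 = beta) any two phantoms weigh at least `VG a b' + VG a' b`
  have L3 : ∀ a a' b b', a < a' → b < b' → ∀ X Y : Finset (Fin m × Fin m), IsPMatching X → IsPMatching Y →
      rng X = G → rng Y = G → dom X = insert (rJ b) (insert (rJ b') N) → dom Y = insert (rI a) (insert (rI a') N) →
      (∀ e ∈ X, ε e.1 e.2 (κ e.2) ≠ 0) → (∀ e ∈ Y, ε e.1 e.2 (κ e.2) ≠ 0) →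
      VG a b' + VG a' b ≤ (∑ e ∈ X, v e.1 e.2 (κ e.2)) + ∑ e ∈ Y, v e.1 e.2 (κ e.2) := by
    intro a a' b b' ha hb X Y hX hY hrX hrY hdX hdY hpX hpY
    have haa : rI a ≠ rI a' := fun h => (ne_of_lt ha) (hI h)
    have hbb : rJ b ≠ rJ b' := fun h => (ne_of_lt hb) (hJ h)
    have hcard : Y.card = X.card := by rw [← hY.card_rng, ← hX.card_rng, hrY, hrX]
    have hx : rI a ∈ dom Y := by rw [hdY]; simp
    have hx' : rI a ∉ dom X := by
      rw [hdX]; simp only [Finset.mem_insert, not_or]; exact ⟨hIJ a b, hIJ a b', hIN a⟩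
    obtain ⟨z, hz, hz', X'', Y'', hX'', hY'', hU, hInt, hrX'', hrY'', hdX'', hdY''⟩ :=
      basis_exchange hY hX hcard (hrY.trans hrX.symm) hx hx'
    have hwt := wt_add_eq hU hInt (fun e => v e.1 e.2 (κ e.2))
    have hpres'' : ∀ e ∈ X'' ∪ Y'', ε e.1 e.2 (κ e.2) ≠ 0 := by
      rw [hU]; intro e he
      rcases Finset.mem_union.1 he with he | he
      · exact hpY e he
      · exact hpX e he
    have hpX'' : ∀ e ∈ X'', ε e.1 e.2 (κ e.2) ≠ 0 := fun e he => hpres'' e (Finset.mem_union_left _ he)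
    have hpY'' : ∀ e ∈ Y'', ε e.1 e.2 (κ e.2) ≠ 0 := fun e he => hpres'' e (Finset.mem_union_right _ he)
    rw [hdY] at hdX''
    rw [hdX, Finset.mem_insert, Finset.mem_insert] at hz
    have hzN : z ∉ N := fun h => hz' (hdY ▸ Finset.mem_insert_of_mem (Finset.mem_insert_of_mem h))
    have hdX''' : dom X'' = insert z (insert (rI a') N) := by
      rw [hdX'', Finset.erase_insert]
      simp only [Finset.mem_insert, not_or]; exact ⟨haa, hIN a⟩
    rcases hz with hz | hz | hz
    · -- `z = rJ b`: the exchange exposes `(a', b)` and `(a, b')`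
      subst hz
      have h1 : VG a' b ≤ ∑ e ∈ X'', v e.1 e.2 (κ e.2) :=
        hmin a' b X'' hX'' (hrX''.trans hrY) (by rw [hdX''', Finset.insert_comm]) hpX''
      have h2 : VG a b' ≤ ∑ e ∈ Y'', v e.1 e.2 (κ e.2) :=
        hmin a b' Y'' hY'' (hrY''.trans hrY) (by rw [hdY'', hdX, Finset.erase_insert]; simp [hbb, hJN b]) hpY''
      linarith
    · -- `z = rJ b'`: the exchange exposes `(a', b')` and `(a, b)`
      subst hz
      have h1 : VG a' b' ≤ ∑ e ∈ X'', v e.1 e.2 (κ e.2) :=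
        hmin a' b' X'' hX'' (hrX''.trans hrY) (by rw [hdX''', Finset.insert_comm]) hpX''
      have h2 : VG a b ≤ ∑ e ∈ Y'', v e.1 e.2 (κ e.2) :=
        hmin a b Y'' hY'' (hrY''.trans hrY) (by rw [hdY'', hdX, erase_insert_insert hbb (hJN b')]) hpY''
      have := L1 a a' b b' ha hb
      linarith
    · exact absurd hz hzN
  -- (L2 = alpha) the phantoms exist, with total weight `VG a b' + VG a' b`
  have L2 : ∀ a a' b b', a < a' → b < b' → ∃ X Y : Finset (Fin m × Fin m), IsPMatching X ∧ IsPMatching Y ∧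
      rng X = G ∧ rng Y = G ∧ dom X = insert (rJ b) (insert (rJ b') N) ∧ dom Y = insert (rI a) (insert (rI a') N) ∧
      (∀ e ∈ X, ε e.1 e.2 (κ e.2) ≠ 0) ∧ (∀ e ∈ Y, ε e.1 e.2 (κ e.2) ≠ 0) ∧
      (∑ e ∈ X, v e.1 e.2 (κ e.2)) + ∑ e ∈ Y, v e.1 e.2 (κ e.2) = VG a b' + VG a' b := by
    intro a a' b b' ha hb
    have haa : rI a ≠ rI a' := fun h => (ne_of_lt ha) (hI h)
    have hbb : rJ b ≠ rJ b' := fun h => (ne_of_lt hb) (hJ h)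
    set M := G.image fun g => ((u a b').1 g, g) with hMdef
    set M' := G.image fun g => ((u a' b).1 g, g) with hM'def
    have hcard : M.card = M'.card := by rw [card_gad, card_gad]
    have hx : rI a ∈ dom M := by rw [hMdom]; simp
    have hx' : rI a ∉ dom M' := by
      rw [hMdom]; simp only [Finset.mem_insert, not_or]; exact ⟨haa, hIJ a b, hIN a⟩
    obtain ⟨z, hz, hz', X, Y, hX, hY, hU, hInt, hrX, hrY, hdX, hdY⟩ :=
      basis_exchange (hM a b') (hM a' b) hcard (by rw [rng_gad, rng_gad]) hx hx'
    have hwt := wt_add_eq hU hInt (fun e => v e.1 e.2 (κ e.2))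
    rw [hMwt, hMwt] at hwt
    have hpres'' : ∀ e ∈ X ∪ Y, ε e.1 e.2 (κ e.2) ≠ 0 := by
      rw [hU]; intro e he
      rcases Finset.mem_union.1 he with he | he
      · exact hpresG a b' e he
      · exact hpresG a' b e he
    have hpX : ∀ e ∈ X, ε e.1 e.2 (κ e.2) ≠ 0 := fun e he => hpres'' e (Finset.mem_union_left _ he)
    have hpY : ∀ e ∈ Y, ε e.1 e.2 (κ e.2) ≠ 0 := fun e he => hpres'' e (Finset.mem_union_right _ he)
    have hrGX : rng X = G := by rw [hrX]; exact rng_gad _ _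
    have hrGY : rng Y = G := by rw [hrY]; exact rng_gad _ _
    rw [hMdom] at hdX hdY hz
    rw [hMdom] at hz'
    rw [Finset.mem_insert, Finset.mem_insert] at hz
    have hzN : z ∉ N := fun h => hz' (Finset.mem_insert_of_mem (Finset.mem_insert_of_mem h))
    have hdX' : dom X = insert z (insert (rJ b') N) := by
      rw [hdX, Finset.erase_insert]
      simp only [Finset.mem_insert, not_or]; exact ⟨hIJ a b', hIN a⟩
    rcases hz with hz | hz | hz
    · -- `z = rI a'`: the exchange exposes `(a', b')` and `(a, b)` — excluded by supermodularity
      subst hz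
      have h1 : VG a' b' ≤ ∑ e ∈ X, v e.1 e.2 (κ e.2) := hmin a' b' X hX hrGX hdX' hpX
      have h2 : VG a b ≤ ∑ e ∈ Y, v e.1 e.2 (κ e.2) :=
        hmin a b Y hY hrGY (by rw [hdY, Finset.erase_insert]; simp [hIJ a' b, hIN a']) hpY
      have := L1 a a' b b' ha hb
      exfalso; linarith
    · -- `z = rJ b`: the two phantoms
      subst hz
      refine ⟨X, Y, hX, hY, hrGX, hrGY, ?_, ?_, hpX, hpY, by linarith⟩
      · rw [hdX', Finset.insert_comm]
      · rw [hdY, erase_insert_insert (hIJ a' b) (hJN b), Finset.insert_comm]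
    · exact absurd hz hzN
  -- (L4) the four minors
  have h01 : (0 : Fin 3) < 1 := by decide
  have h02 : (0 : Fin 3) < 2 := by decide
  have h12 : (1 : Fin 3) < 2 := by decide
  obtain ⟨X1, Y1, hX1, hY1, rX1, rY1, dX1, dY1, pX1, pY1, w1⟩ := L2 0 1 0 2 h01 h02
  obtain ⟨X2, Y2, hX2, hY2, rX2, rY2, dX2, dY2, pX2, pY2, w2⟩ := L2 0 1 1 2 h01 h12
  obtain ⟨X3, Y3, hX3, hY3, rX3, rY3, dX3, dY3, pX3, pY3, w3⟩ := L2 0 2 0 2 h02 h02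
  obtain ⟨X4, Y4, hX4, hY4, rX4, rY4, dX4, dY4, pX4, pY4, w4⟩ := L2 0 2 1 2 h02 h12
  have b12 := L3 0 1 0 2 h01 h02 X1 Y2 hX1 hY2 rX1 rY2 dX1 dY2 pX1 pY2
  have b21 := L3 0 1 1 2 h01 h12 X2 Y1 hX2 hY1 rX2 rY1 dX2 dY1 pX2 pY1
  have b34 := L3 0 2 0 2 h02 h02 X3 Y4 hX3 hY4 rX3 rY4 dX3 dY4 pX3 pY4
  have b43 := L3 0 2 1 2 h02 h12 X4 Y3 hX4 hY3 rX4 rY3 dX4 dY3 pX4 pY3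
  have b31 := L3 0 1 0 2 h01 h02 X3 Y1 hX3 hY1 rX3 rY1 dX3 dY1 pX3 pY1
  have b13 := L3 0 2 0 2 h02 h02 X1 Y3 hX1 hY3 rX1 rY3 dX1 dY3 pX1 pY3
  have b42 := L3 0 1 1 2 h01 h12 X4 Y2 hX4 hY2 rX4 rY2 dX4 dY2 pX4 pY2
  have b24 := L3 0 2 1 2 h02 h12 X2 Y4 hX2 hY4 rX2 rY4 dX2 dY4 pX2 pY4
  have key := L1 1 2 0 1 h12 h01
  linarith


end RegisterPair

end Summit.ValiantsHypothesis.ValiantsHypothesis.Theorems.KPlusLogSqLaw
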